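import Mathlib
import HarnessLib
import Summits.Ventures.LatticeQCDFlow.Exactness.SU2ResidualExactForceRegularUniform
import Summits.Ventures.LatticeQCDFlow.Exactness.SU2ResidualExactForceFTHMCN
import Summits.Ventures.LatticeQCDFlow.Exactness.SU2ExactForceVolumeUniform

/-!
# VOLUME-UNIFORMITY FOR THE LEARNED MEMBER: with ONE covering-natural, translation-covariant, staple-local, smooth conditioner evaluated on every torus, the exact force through the learned `SU(2)` residual member is bounded and Lipschitz with constants that do NOT depend on the lattice side, and multi-step FT-HMC with the exact force as run converges below ONE trajectory-length threshold `τ₀` for EVERY volume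

HONEST FRAMING: exact (Metropolis-corrected) sampling algorithms for lattice gauge theory;
figures of merit are autocorrelation/cost numbers at stated couplings and volumes; no
continuum-physics claim.

Venture `LatticeQCDFlow` (cell pub-lqcd), topic `Exactness`; FANOUT row 14 (`eng-flowhmc`, engine
`latflow.fthmc`, family B: FT-HMC through the LEARNED residual member `maps.residual_trained_scan` on
`SU(2)` with the exact autodiff force, row 9's `n`-step Pauli-drift kernel `su2LeapfrogHMCN`).  NEW WORK
of the cell over the tree (`SU2ResidualExactForceRegularUniform`: §1 below — the volume-free `Φ_max`, `K_Φ`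
(GEN-17 split: the regularity half is its own file); `SU2ResidualExactForceFTHMCN`
(GEN-14): the learned-member package; `SUNMultiStepLeapfrogFTHMCErgodic`: the trajectory-length form of
the multi-step convergence theorem with `τ₀ = τ₀(Φ_max, K_Φ)` chosen BEFORE the link type;
`SU2ExactForceVolumeUniform`: the LO special case; `LatticeForceVolumeUniform`: `phaseMask_proper`,
`phaseMask_pull`; `SU2ExactForceTransplant.norm_transplant_sub_le`; `SU2LeapfrogHMCWilson`:
`su2GibbsLaw = wilsonMeasure`); nothing is cited as a fact; no number.  Fifth and last file of the
GEN-16 programme (VOLUME-UNIFORMITY for the LEARNED members); it CLOSES the NOT-CLAIMED item "the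
learned residual members" of the GEN-15 card (`SU2ExactForceVolumeUniform`).  Masks = the engine's
phase masks `x ↦ Σᵢ xᵢ mod w` (`w ∣ L`; parity: `w = 2`), written VERBATIM as
`ZMod.castHom hwL (ZMod w) (∑ j, x j)`; layer specs `s : σ` with direction `μf s`, class `bf s : ZMod w`,
step `cf s`.

THE NETWORK.  A weight FAMILY `ρF M` indexed by the side `M` — ONE conditioner evaluated on every torus —
entering ONLY through the hypotheses
  (ρN) covering naturality along every `ZMod.castHom`, `w ∣ M ∣ M'`;  (ρT) covariance under the translations
  preserving the phase mask, on every torus `w ∣ M`;  (ρL) receptive radius `m` (weights at `e` read the `(m+1)`-ball at `e.1`);  (ρD)/(ρC) differentiable along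
  differentiable link fields and `C^n` along `C^n` link fields (a smooth network);  (ρm) measurable;
  (ρloc) the weights at active links do not read active links;  (ρκ) the uniform refusal bound
  `|c_s|·Σ_ν(|ρ⁰| + |ρ¹|) ≤ κ₀ < 1` on every torus.
A convolutional conditioner with SHARED weights, periodic padding, frozen-plaquette features and the
tanh squash meets them: (ρN), (ρT), (ρL), (ρloc), (ρm) are TYPED for window-stencil conditioners in
`LatticeStencilConditioner`, (ρκ) for the tanh squash in `SU2ResidualSquash`; (ρD)/(ρC) is a property
of the activation (smooth activations yes, LeakyReLU no).  PER-VOLUME RETRAINED WEIGHTS ARE A DIFFERENT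
MEMBER ON EVERY TORUS — nothing here applies.

* §1 (in `SU2ResidualExactForceRegularUniform`) **`su2Residual_exactForce_regular_uniform`** — every schedule `sched`, `β, κ`: THERE ARE
  `Φ_max, K_Φ ≥ 0` SUCH THAT FOR EVERY SIDE `L` with `w ∣ L` and every `layers` packaged VERBATIM as in
  `exists_layers_su2Residual` with the weights `ρF L` (positive densities) the exact force is measurable,
  `‖Φ_κ(V)_l‖ ≤ Φ_max`, `‖Φ_κ(V) − Φ_κ(V')‖ ≤ K_Φ‖V − V'‖_∞` (`Φ_max`, `K_Φ` = GEN-14's compactness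
  constants on the reference torus of side `w(4(m+1)K+5)`, `K = sched.length`);
* §2 **`su2Residual_member_fthmcN_exactForce_uniformlyErgodic_allVolumes`** — THERE IS `τ₀ > 0`
  (depending on `d, w, m, sched, μf, bf, cf, ρF, β, κ, κ'` ONLY) SUCH THAT FOR EVERY SIDE `L` with `w ∣ L`:
  the learned member exists (layers VERBATIM), its exact force is measurable, and for every `n ≥ 1`,
  `ε' > 0` with `nε' ≤ τ₀` the reported `n`-step FT-HMC kernel driven by `−(ε'/2)Φ_κ` converges to
  `wilsonMeasure SU(2).subtype β` from EVERY initial law, geometrically in total variation.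

NOT CLAIMED: the VALUE of `τ₀`; that the RATE is volume-uniform (only the THRESHOLD is); that a given
trained network meets (ρN)…(ρκ); layers of different receptive radii (take the largest `m`); longer
trajectories; OMF; floating point.
-/

noncomputable section

namespace Summit.Ventures.LatticeQCDFlow.Exactness

open Set Function MeasureTheory ProbabilityTheory ProbabilityTheory.Kernel InnerProductGeometry WithLp NormedSpace
open Literature.MathematicalPhysics.QuantumFieldTheory
open Literature.MathematicalPhysics.QuantumFieldTheory.Balaban1983to89.B10Eq18SigmaSU2Haar (expPauli)
open scoped ENNReal Matrix Matrix.Norms.Operator NNReal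

set_option backward.isDefEq.respectTransparency false

section Uniform

variable {d : ℕ} {σ : Type*}

/-! ## §2 One trajectory-length threshold for every volume -/

/-- **MULTI-STEP FT-HMC THROUGH THE LEARNED `SU(2)` RESIDUAL MEMBER WITH THE EXACT FORCE AS RUN CONVERGES
BELOW ONE TRAJECTORY-LENGTH THRESHOLD FOR EVERY VOLUME** — ONE conditioner evaluated on every torus
((ρN), (ρT), (ρL), (ρD), (ρC), (ρm), (ρloc), (ρκ) with `0 ≤ κ₀ < 1`).  Phase masks of width `w > 1`
(parity: `w = 2`), ANY schedule, every `β, κ`, `κ' > 0`: THERE IS `τ₀ > 0` such that FOR EVERY side `L`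
with `w ∣ L`: there are `layers` (VERBATIM: the learned residual layers of the schedule with weights
`ρF L` and their booked densities) whose exact force `Φ_κ` is measurable, and for every `n ≥ 1`,
`ε' > 0` with `nε' ≤ τ₀` the reported `n`-step kernel
`conjKernel (su2LeapfrogHMCN ε' κ' (−(ε'/2)Φ_κ) (βS_W∘F − log J) n) F` converges to
`wilsonMeasure SU(2).subtype β` from EVERY initial law, geometrically in total variation. -/
theorem su2Residual_member_fthmcN_exactForce_uniformlyErgodic_allVolumes (w : ℕ) [Fact (1 < w)]
    (μf : σ → Fin d) (bf : σ → ZMod w) (cf : σ → ℝ)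
    (ρF : ∀ M : ℕ, σ → GaugeConfig d M (Matrix.specialUnitaryGroup (Fin 2) ℂ) → Edge d M → Fin d → Fin 2 → ℝ) (m : ℕ)
    (hρN : (∀ (M M' : ℕ) (hwM : w ∣ M) (hMM : M ∣ M') (s : σ) (V : GaugeConfig d M (Matrix.specialUnitaryGroup (Fin 2) ℂ)) (e : Edge d M') (ν : Fin d) (t : Fin 2),
      ρF M' s (fun e : Edge d M' => V (fun i => ZMod.castHom hMM (ZMod M) (e.1 i), e.2)) e ν t =
        ρF M s V ((fun j => ZMod.castHom hMM (ZMod M) (e.1 j)), e.2) ν t))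
    (hρT : (∀ (M : ℕ) (hwM : w ∣ M) (t : Site d M), (∀ x : Site d M, ZMod.castHom hwM (ZMod w) (∑ j, (x + t) j) = ZMod.castHom hwM (ZMod w) (∑ j, x j)) →
      ∀ (s : σ) (W : GaugeConfig d M (Matrix.specialUnitaryGroup (Fin 2) ℂ)) (e : Edge d M) (ν : Fin d) (b : Fin 2),
      ρF M s (fun e : Edge d M => W (e.1 + t, e.2)) e ν b = ρF M s W (e.1 + t, e.2) ν b))
    (hρL : (∀ (M : ℕ) (s : σ) (U U' : GaugeConfig d M (Matrix.specialUnitaryGroup (Fin 2) ℂ)) (x : Site d M) (r : ℕ),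
      (∀ e : Edge d M, (∃ z : Fin d → ℤ, (∀ i, |z i| ≤ (((r+m+1) : ℕ) : ℤ)) ∧ e.1 = x + fun i => ((z i : ℤ) : ZMod M)) → U e = U' e) →
      ∀ e : Edge d M, (∃ z : Fin d → ℤ, (∀ i, |z i| ≤ ((r : ℕ) : ℤ)) ∧ e.1 = x + fun i => ((z i : ℤ) : ZMod M)) → ∀ (ν : Fin d) (t : Fin 2), ρF M s U e ν t = ρF M s U' e ν t))
    (hρD : (∀ (M : ℕ) [NeZero M] (s : σ) (U : (Edge d M → EuclideanSpace ℝ (Fin 3)) → GaugeConfig d M (Matrix.specialUnitaryGroup (Fin 2) ℂ))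
      (p₀ : Edge d M → EuclideanSpace ℝ (Fin 3)),
      (∀ e : Edge d M, DifferentiableAt ℝ (fun p => ((U p e : (Matrix.specialUnitaryGroup (Fin 2) ℂ)) : Matrix (Fin 2) (Fin 2) ℂ)) p₀) →
      ∀ (e : Edge d M) (ν : Fin d) (b : Fin 2), DifferentiableAt ℝ (fun p => ρF M s (U p) e ν b) p₀))
    (hρC : (∀ (M : ℕ) [NeZero M] {n : WithTop ℕ∞} (s : σ) (U : (Edge d M → Matrix (Fin 2) (Fin 2) ℂ) × (Edge d M → EuclideanSpace ℝ (Fin 3)) → GaugeConfig d M (Matrix.specialUnitaryGroup (Fin 2) ℂ)) (p₀ : (Edge d M → Matrix (Fin 2) (Fin 2) ℂ) × (Edge d M → EuclideanSpace ℝ (Fin 3))),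
      (∀ e : Edge d M, ContDiffAt ℝ n (fun p : (Edge d M → Matrix (Fin 2) (Fin 2) ℂ) × (Edge d M → EuclideanSpace ℝ (Fin 3)) => ((U p e : (Matrix.specialUnitaryGroup (Fin 2) ℂ)) : Matrix (Fin 2) (Fin 2) ℂ)) p₀) →
      ∀ (e : Edge d M) (ν : Fin d) (b : Fin 2), ContDiffAt ℝ n (fun p : (Edge d M → Matrix (Fin 2) (Fin 2) ℂ) × (Edge d M → EuclideanSpace ℝ (Fin 3)) => ρF M s (U p) e ν b) p₀))
    (hρm : (∀ (M : ℕ) (s : σ) (e : Edge d M) (ν : Fin d) (t : Fin 2), Measurable fun V : GaugeConfig d M (Matrix.specialUnitaryGroup (Fin 2) ℂ) => ρF M s V e ν t))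
    (hρloc : (∀ (M : ℕ) (hwM : w ∣ M) (s : σ) (V W : GaugeConfig d M (Matrix.specialUnitaryGroup (Fin 2) ℂ)),
      (∀ j : Edge d M, ¬(j.2 = μf s ∧ ZMod.castHom hwM (ZMod w) (∑ i, j.1 i) = bf s) → V j = W j) →
        ∀ e : Edge d M, (e.2 = μf s ∧ ZMod.castHom hwM (ZMod w) (∑ i, e.1 i) = bf s) → ∀ (ν : Fin d) (t : Fin 2), ρF M s V e ν t = ρF M s W e ν t))
    {κ₀ : ℝ} (hκ0 : 0 ≤ κ₀) (hκ₀ : κ₀ < 1) (hκ : (∀ (M : ℕ) (hwM : w ∣ M) (s : σ) (V : GaugeConfig d M (Matrix.specialUnitaryGroup (Fin 2) ℂ)) (e : Edge d M), (e.2 = μf s ∧ ZMod.castHom hwM (ZMod w) (∑ i, e.1 i) = bf s) →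
      |cf s| * ∑ ν ∈ Finset.univ.erase e.2, (|ρF M s V e ν 0| + |ρF M s V e ν 1|) ≤ κ₀))
    (sched : List σ) (β κ : ℝ) {κ' : ℝ} (hκ' : 0 < κ') :
    ∃ τ₀ : ℝ, 0 < τ₀ ∧ ∀ (L : ℕ) [NeZero L] (hwL : w ∣ L),
    ∃ layers : List ((GaugeConfig d L (Matrix.specialUnitaryGroup (Fin 2) ℂ) ≃ᵐ GaugeConfig d L (Matrix.specialUnitaryGroup (Fin 2) ℂ)) × (GaugeConfig d L (Matrix.specialUnitaryGroup (Fin 2) ℂ) → ℝ)),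
      layers.map (fun Ly => ((Ly.1 : GaugeConfig d L (Matrix.specialUnitaryGroup (Fin 2) ℂ) → GaugeConfig d L (Matrix.specialUnitaryGroup (Fin 2) ℂ)), Ly.2)) =
        sched.map (fun s =>
          ((fun (V : GaugeConfig d L (Matrix.specialUnitaryGroup (Fin 2) ℂ)) (e : Edge d L) =>
        if e.2 = μf s ∧ (ZMod.castHom hwL (ZMod w) (∑ j, e.1 j)) = bf s then
          gaussUnit (geodesicKick (cf s) (∑ ν ∈ Finset.univ.erase e.2,
            (ρF L s V e ν 0 • vecQuat (((V (Site.shift e.1 e.2, ν) * (V (Site.shift e.1 ν, e.2))⁻¹ * (V (e.1, ν))⁻¹)⁻¹ : Matrix.specialUnitaryGroup (Fin 2) ℂ) : Matrix (Fin 2) (Fin 2) ℂ) +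
              ρF L s V e ν 1 • vecQuat ((((V (Site.shift (e.1 - Pi.single ν 1) e.2, ν))⁻¹ * (V (e.1 - Pi.single ν 1, e.2))⁻¹ * V (e.1 - Pi.single ν 1, ν))⁻¹ : Matrix.specialUnitaryGroup (Fin 2) ℂ) : Matrix (Fin 2) (Fin 2) ℂ)))
            (vecQuat ((V e : Matrix.specialUnitaryGroup (Fin 2) ℂ) : Matrix (Fin 2) (Fin 2) ℂ)))
        else V e),
           fun V : GaugeConfig d L (Matrix.specialUnitaryGroup (Fin 2) ℂ) => ∏ a : {e : Edge d L // e.2 = μf s ∧ (ZMod.castHom hwL (ZMod w) (∑ j, e.1 j)) = bf s},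
          (if Real.sin (angle (∑ ν ∈ Finset.univ.erase a.1.2,
            (ρF L s V a.1 ν 0 • vecQuat (((V (Site.shift a.1.1 a.1.2, ν) * (V (Site.shift a.1.1 ν, a.1.2))⁻¹ * (V (a.1.1, ν))⁻¹)⁻¹ : Matrix.specialUnitaryGroup (Fin 2) ℂ) : Matrix (Fin 2) (Fin 2) ℂ) +
              ρF L s V a.1 ν 1 • vecQuat ((((V (Site.shift (a.1.1 - Pi.single ν 1) a.1.2, ν))⁻¹ * (V (a.1.1 - Pi.single ν 1, a.1.2))⁻¹ * V (a.1.1 - Pi.single ν 1, ν))⁻¹ : Matrix.specialUnitaryGroup (Fin 2) ℂ) : Matrix (Fin 2) (Fin 2) ℂ))) (vecQuat ((V a.1 : Matrix.specialUnitaryGroup (Fin 2) ℂ) : Matrix (Fin 2) (Fin 2) ℂ))) = 0 then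
            (1 - cf s * ‖(∑ ν ∈ Finset.univ.erase a.1.2,
            (ρF L s V a.1 ν 0 • vecQuat (((V (Site.shift a.1.1 a.1.2, ν) * (V (Site.shift a.1.1 ν, a.1.2))⁻¹ * (V (a.1.1, ν))⁻¹)⁻¹ : Matrix.specialUnitaryGroup (Fin 2) ℂ) : Matrix (Fin 2) (Fin 2) ℂ) +
              ρF L s V a.1 ν 1 • vecQuat ((((V (Site.shift (a.1.1 - Pi.single ν 1) a.1.2, ν))⁻¹ * (V (a.1.1 - Pi.single ν 1, a.1.2))⁻¹ * V (a.1.1 - Pi.single ν 1, ν))⁻¹ : Matrix.specialUnitaryGroup (Fin 2) ℂ) : Matrix (Fin 2) (Fin 2) ℂ)))‖ * Real.cos (angle (∑ ν ∈ Finset.univ.erase a.1.2,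
            (ρF L s V a.1 ν 0 • vecQuat (((V (Site.shift a.1.1 a.1.2, ν) * (V (Site.shift a.1.1 ν, a.1.2))⁻¹ * (V (a.1.1, ν))⁻¹)⁻¹ : Matrix.specialUnitaryGroup (Fin 2) ℂ) : Matrix (Fin 2) (Fin 2) ℂ) +
              ρF L s V a.1 ν 1 • vecQuat ((((V (Site.shift (a.1.1 - Pi.single ν 1) a.1.2, ν))⁻¹ * (V (a.1.1 - Pi.single ν 1, a.1.2))⁻¹ * V (a.1.1 - Pi.single ν 1, ν))⁻¹ : Matrix.specialUnitaryGroup (Fin 2) ℂ) : Matrix (Fin 2) (Fin 2) ℂ))) (vecQuat ((V a.1 : Matrix.specialUnitaryGroup (Fin 2) ℂ) : Matrix (Fin 2) (Fin 2) ℂ)))) ^ 3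
          else kickJac (cf s * ‖(∑ ν ∈ Finset.univ.erase a.1.2,
            (ρF L s V a.1 ν 0 • vecQuat (((V (Site.shift a.1.1 a.1.2, ν) * (V (Site.shift a.1.1 ν, a.1.2))⁻¹ * (V (a.1.1, ν))⁻¹)⁻¹ : Matrix.specialUnitaryGroup (Fin 2) ℂ) : Matrix (Fin 2) (Fin 2) ℂ) +
              ρF L s V a.1 ν 1 • vecQuat ((((V (Site.shift (a.1.1 - Pi.single ν 1) a.1.2, ν))⁻¹ * (V (a.1.1 - Pi.single ν 1, a.1.2))⁻¹ * V (a.1.1 - Pi.single ν 1, ν))⁻¹ : Matrix.specialUnitaryGroup (Fin 2) ℂ) : Matrix (Fin 2) (Fin 2) ℂ)))‖) 2 (angle (∑ ν ∈ Finset.univ.erase a.1.2,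
            (ρF L s V a.1 ν 0 • vecQuat (((V (Site.shift a.1.1 a.1.2, ν) * (V (Site.shift a.1.1 ν, a.1.2))⁻¹ * (V (a.1.1, ν))⁻¹)⁻¹ : Matrix.specialUnitaryGroup (Fin 2) ℂ) : Matrix (Fin 2) (Fin 2) ℂ) +
              ρF L s V a.1 ν 1 • vecQuat ((((V (Site.shift (a.1.1 - Pi.single ν 1) a.1.2, ν))⁻¹ * (V (a.1.1 - Pi.single ν 1, a.1.2))⁻¹ * V (a.1.1 - Pi.single ν 1, ν))⁻¹ : Matrix.specialUnitaryGroup (Fin 2) ℂ) : Matrix (Fin 2) (Fin 2) ℂ))) (vecQuat ((V a.1 : Matrix.specialUnitaryGroup (Fin 2) ℂ) : Matrix (Fin 2) (Fin 2) ℂ)))))) ∧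
      ∃ hΦ : Measurable (fun (V : GaugeConfig d L (Matrix.specialUnitaryGroup (Fin 2) ℂ)) (l : Edge d L) => κ • WithLp.toLp 2 (fun i : Fin 3 =>
        fderiv ℝ (fun a : Edge d L → EuclideanSpace ℝ (Fin 3) => β * wilsonAction (Matrix.specialUnitaryGroup (Fin 2) ℂ).subtype ((layers.foldr (fun Ly (F : GaugeConfig d L (Matrix.specialUnitaryGroup (Fin 2) ℂ) ≃ᵐ GaugeConfig d L (Matrix.specialUnitaryGroup (Fin 2) ℂ)) => Ly.1.trans F) (MeasurableEquiv.refl (GaugeConfig d L (Matrix.specialUnitaryGroup (Fin 2) ℂ)))) ((fun l : Edge d L => expPauli (a l)) * V)) - Real.log ((layers.foldr (fun Ly K => fun v => Ly.2 v * K (Ly.1 v)) (fun _ => (1 : ℝ))) ((fun l : Edge d L => expPauli (a l)) * V))) 0 (Pi.single l (EuclideanSpace.single i (1 : ℝ))))),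
      ∀ (n : ℕ) (ε' : ℝ) (_hn : 1 ≤ n) (_hε' : 0 < ε'), n * ε' ≤ τ₀ →
        ∃ k : ℕ, ∃ δ : ℝ, 0 < δ ∧ δ ≤ 1 ∧ ∀ (μ₀ : Measure (GaugeConfig d L (Matrix.specialUnitaryGroup (Fin 2) ℂ))) [IsProbabilityMeasure μ₀] (t : ℕ) (A : Set (GaugeConfig d L (Matrix.specialUnitaryGroup (Fin 2) ℂ))),
          |((fun m : Measure (GaugeConfig d L (Matrix.specialUnitaryGroup (Fin 2) ℂ)) =>
                m.bind (conjKernel (su2LeapfrogHMCN ε' κ' (measurable_halfKick_su2 hΦ ε')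
                  (fun V : GaugeConfig d L (Matrix.specialUnitaryGroup (Fin 2) ℂ) => β * wilsonAction (Matrix.specialUnitaryGroup (Fin 2) ℂ).subtype ((layers.foldr (fun Ly (F : GaugeConfig d L (Matrix.specialUnitaryGroup (Fin 2) ℂ) ≃ᵐ GaugeConfig d L (Matrix.specialUnitaryGroup (Fin 2) ℂ)) => Ly.1.trans F) (MeasurableEquiv.refl (GaugeConfig d L (Matrix.specialUnitaryGroup (Fin 2) ℂ)))) V) - Real.log ((layers.foldr (fun Ly K => fun v => Ly.2 v * K (Ly.1 v)) (fun _ => (1 : ℝ))) V)) n) (layers.foldr (fun Ly (F : GaugeConfig d L (Matrix.specialUnitaryGroup (Fin 2) ℂ) ≃ᵐ GaugeConfig d L (Matrix.specialUnitaryGroup (Fin 2) ℂ)) => Ly.1.trans F) (MeasurableEquiv.refl (GaugeConfig d L (Matrix.specialUnitaryGroup (Fin 2) ℂ))))))^[t] μ₀).real A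
            - (wilsonMeasure (Matrix.specialUnitaryGroup (Fin 2) ℂ).subtype β).real A| ≤ (1 - δ) ^ (t / (k + 1)) := by
  obtain ⟨Φmax, KΦ, hΦ0, hK0, hreg⟩ := su2Residual_exactForce_regular_uniform (d := d) w μf bf cf ρF m
    hρN hρT hρL hρD hρC hρm hρloc hκ₀ hκ sched β κ
  obtain ⟨τ₀, hτ₀, hconv⟩ := su2LeapfrogFTHMCN_uniformlyErgodic_of_trajLength_uniform hκ' hΦ0 hK0
  refine ⟨τ₀, hτ₀, fun L _ hwL => ?_⟩
  have hχ : ∀ (x : Site d L) (i : Fin d),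
      ZMod.castHom hwL (ZMod w) (∑ j, (Site.shift x i) j) ≠ ZMod.castHom hwL (ZMod w) (∑ j, x j) :=
    fun x i => phaseMask_proper hwL x i
  obtain ⟨layers, hmap, hpos, hfmeas, hfjac, hfold⟩ := su2Residual_member_package
    (fun x : Site d L => ZMod.castHom hwL (ZMod w) (∑ j, x j)) hχ μf bf cf (ρF L) (hρm L) (hρloc L hwL) hκ0 hκ₀
    (hκ L hwL) sched
  refine ⟨layers, hmap, ?_⟩
  obtain ⟨hΦm, hb, hK⟩ := hreg L hwL layers hmap hpos
  refine ⟨hΦm, fun n ε' hn hε' hτ => ?_⟩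
  have hρc : Continuous ⇑((Matrix.specialUnitaryGroup (Fin 2) ℂ).subtype) := continuous_subtype_val
  have hSc : Continuous fun U : GaugeConfig d L (Matrix.specialUnitaryGroup (Fin 2) ℂ) =>
      β * wilsonAction (Matrix.specialUnitaryGroup (Fin 2) ℂ).subtype U :=
    continuous_smul_wilsonAction _ hρc β
  obtain ⟨s, hs⟩ := exists_bound_smul_wilsonAction (d := d) (L := L) (Matrix.specialUnitaryGroup (Fin 2) ℂ).subtype hρc β
  obtain ⟨k, δ, hδ0, hδ1, hbound⟩ := hconv (Edge d L) hΦm hb hK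
    (S := fun U : GaugeConfig d L (Matrix.specialUnitaryGroup (Fin 2) ℂ) =>
      β * wilsonAction (Matrix.specialUnitaryGroup (Fin 2) ℂ).subtype U)
    hSc.measurable hs (pow_pos (pow_pos (by linarith) _) _) (fun v => (hfold v).1) (fun v => (hfold v).2) hfmeas hfjac
    n ε' hn hε' hτ
  refine ⟨k, δ, hδ0, hδ1, fun μ₀ _ t A => ?_⟩
  rw [← su2GibbsLaw_eq_wilsonMeasure (d := d) (L := L) (Matrix.specialUnitaryGroup (Fin 2) ℂ).subtype β]
  exact hbound μ₀ t A

end Uniform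

end Summit.Ventures.LatticeQCDFlow.Exactness
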